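import Literature.Probability.RandomPlanarGeometry.HexSAWPolygonCellsHosts
import HarnessLib

/-!
# Cell calculus for honeycomb polygon surgery, VIII: DIAGONAL SEPARATION of the ports of the flip and of the roof ((P3) of Lemma P)

Topic `Literature/Probability/RandomPlanarGeometry` (lane «pcv-sawmu», a-p4 g21; sequel of `HexSAWPolygonCellsHosts.lean`).

(P3) of LEMMA P in `HOME/pub-sawmu-a-p4/g21/omega/THEOREM-OMEGA-g21.md` §2: the ports of two distinct hosts of a base lie on UR-diagonals
`x − y` at distance `≥ 4` — hence a re-grown stick of spikes never touches another one nor another port.  This file proves it for the two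
Madras–Slade bases: `portX` (flip: `t ↦ UR (UL t)`, `d ↦ UR d` otherwise) and `portR` (roof of length `k`: `t ↦ UR a_{k−1}`, `d ↦ UR d`
otherwise, hosts in the run excluded), from the host geometry `IsHost.row_cases`, the right-end property `R d ∉ S`, and brick parity.
Auxiliary: `IsHost.sameRow_gap` (two hosts on one row are `≥ 4` apart), `IsHost.topRow_le_of_L_mem` (with `L t ∈ S` a top-row host other
than `t` has abscissa `≤ t.x − 6`), `IsHost.lowRow_ge_of_run` (with the run `e_0..e_{k−1} ⊆ S`, `e_k ∉ S`, a second-row host outside the run has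
abscissa `≥ e_k.x + 2 = t.x + 2k + 3`).

Sources: N. Madras, G. Slade, *The Self-Avoiding Walk* (1993), §3.2, proof of Theorem 3.2.3 [MadrasSlade1993]; I. Jensen, J. Phys.: Conf.
Ser. 42 (2006) 163 [Jensen2006HoneycombPolygons].  Label (lane): LANE INFRASTRUCTURE; nothing new in writing.
-/

open Finset

namespace Literature.Probability.RandomPlanarGeometry.SAW

namespace HexCell

/-- The UR-diagonal index `x − y` of a hexagon. [cite: Jensen2006HoneycombPolygons, §2] -/
def diag (c : Cell) : ℤ := c.1 - c.2

/-- `diag` is invariant under `UR`. [cite: Jensen2006HoneycombPolygons, §2] -/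
@[simp] theorem diag_ur (c : Cell) : diag (UR c) = diag c := by simp [diag, UR]

/-- Two distinct hosts on the same row are at least `4` apart (they are right ends of distinct runs; parity makes the gap even).
[cite: MadrasSlade1993, §3.2 (proof of Theorem 3.2.3)] -/
theorem IsHost.sameRow_gap {S : Finset Cell} {d d' : Cell} (hS : IsBrickSet S) (hd : IsHost S d) (hd' : IsHost S d')
    (hrow : d.2 = d'.2) (hne : d ≠ d') : 4 ≤ |d.1 - d'.1| := by
  obtain ⟨x, y⟩ := d
  obtain ⟨x', y'⟩ := d'
  simp only at hrow; subst hrow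
  obtain ⟨m, hm⟩ := hS _ hd.1
  obtain ⟨m', hm'⟩ := hS _ hd'.1
  simp only at hm hm'
  have h2 : x' ≠ x + 2 := by
    intro e; apply hd.2.1
    have : R (x, y) = (x', y) := by ext <;> simp [e]
    rw [this]; exact hd'.1
  have h2' : x ≠ x' + 2 := by
    intro e; apply hd'.2.1
    have : R (x', y) = (x, y) := by ext <;> simp [e]
    rw [this]; exact hd.1
  have h0 : x ≠ x' := by intro e; apply hne; ext <;> simp [e]
  simp only
  rw [le_abs]
  omega

/-- With `L t ∈ S` (class X), a top-row host other than `t` has abscissa `≤ t.x − 6` (the cell at `t.x − 4` would have `R = L t ∈ S`).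
[cite: MadrasSlade1993, §3.2 (proof of Theorem 3.2.3)] -/
theorem IsHost.topRow_le_of_L_mem {S : Finset Cell} {t d : Cell} (hS : IsBrickSet S) (ht : IsLexmax S t) (hL : L t ∈ S)
    (hd : IsHost S d) (hrow : d.2 = t.2) (hne : d ≠ t) : d.1 ≤ t.1 - 6 := by
  rcases hd.row_cases hS ht with ⟨-, -, h⟩ | ⟨h, -⟩
  · rcases h with h | h
    · exact absurd h hne
    · obtain ⟨x, y⟩ := d; obtain ⟨a, b⟩ := t
      simp only at h hrow ⊢
      obtain ⟨m, hm⟩ := hS _ hd.1; obtain ⟨m', hm'⟩ := hS _ ht.1; simp only at hm hm'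
      have h4 : x ≠ a - 4 := by
        intro e; apply hd.2.1
        have : R (x, y) = L (a, b) := by ext <;> simp <;> omega
        rw [this]; exact hL
      omega
  · omega

/-- With the run `e_0..e_{k−1} ⊆ S` and `e_k ∉ S` below-right of the top hexagon, a second-row host that is not in the run has abscissa
`≥ t.x + 2k + 3`. [cite: MadrasSlade1993, §3.2 (proof of Theorem 3.2.3)] -/
theorem IsHost.lowRow_ge_of_run {S : Finset Cell} {t d : Cell} (hS : IsBrickSet S) (ht : IsLexmax S t) {k : ℕ}
    (hrun : ∀ i < k, runCell t i ∈ S) (hend : runCell t k ∉ S) (hd : IsHost S d) (hrow : d.2 = t.2 - 1)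
    (hnot : ∀ i < k, d ≠ runCell t i) : t.1 + 2 * k + 3 ≤ d.1 := by
  obtain ⟨x, y⟩ := d; obtain ⟨a, b⟩ := t
  simp only at hrow ⊢; subst hrow
  rcases hd.row_cases hS ht with ⟨h, -⟩ | ⟨-, h3⟩
  · simp at h
  · simp only at h3
    obtain ⟨m, hm⟩ := hS _ hd.1; obtain ⟨m', hm'⟩ := hS _ ht.1; simp only at hm hm'
    -- `x` is odd-offset from `a`: x = a + 2i + 1 for some integer i ≥ 1; if i < k then d = e_i (excluded); if i = k then d = e_k ∉ S
    by_contra hlt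
    push Not at hlt
    -- so a + 3 ≤ x ≤ a + 2k + 2, x ≡ a + 1 (mod 2)
    obtain ⟨i, hi⟩ : ∃ i : ℕ, x = a + 2 * (i : ℤ) + 1 := ⟨((x - a - 1) / 2).toNat, by omega⟩
    by_cases hik : i < k
    · exact hnot i hik (by ext <;> simp [hi])
    · have : i = k := by omega
      subst this
      exact hend (by have e : runCell (a, b) i = (x, b - 1) := (by ext <;> simp [hi]); rw [e]; exact hd.1)

/-- The ports of the class-X flip. [cite: MadrasSlade1993, §3.2 (proof of Theorem 3.2.3)] -/
def portX (t d : Cell) : Cell := if d = t then UR (UL t) else UR d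

/-- ★ **(P3) for the flip**: distinct hosts have ports on diagonals `≥ 4` apart.
[cite: MadrasSlade1993, §3.2 (proof of Theorem 3.2.3)] -/
theorem portX_diag_gap {S : Finset Cell} {t d d' : Cell} (hS : IsBrickSet S) (ht : IsLexmax S t) (hL : L t ∈ S)
    (hd : IsHost S d) (hd' : IsHost S d') (hne : d ≠ d') : 4 ≤ |diag (portX t d) - diag (portX t d')| := by
  -- reduce to coordinates
  have key : ∀ {u v : Cell}, IsHost S u → IsHost S v → u ≠ v → u ≠ t → 4 ≤ |diag (portX t u) - diag (portX t v)| := by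
    intro u v hu hv huv hut
    have hpu : portX t u = UR u := by simp [portX, hut]
    rcases hu.row_cases hS ht with ⟨hur, -, -⟩ | ⟨hur, hux⟩
    · -- u on the top row, u ≠ t ⇒ u.x ≤ t.x − 6
      have hux := hu.topRow_le_of_L_mem hS ht hL hur hut
      by_cases hvt : v = t
      · subst hvt
        have hpv : portX v v = UR (UL v) := by simp [portX]
        rw [hpu, hpv, diag_ur, diag_ur]
        obtain ⟨a, b⟩ := v; obtain ⟨x, y⟩ := u
        simp only [diag, UL_fst, UL_snd] at hur hux ⊢
        rw [le_abs]; omega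
      · have hpv : portX t v = UR v := by simp [portX, hvt]
        rw [hpu, hpv, diag_ur, diag_ur]
        rcases hv.row_cases hS ht with ⟨hvr, -, -⟩ | ⟨hvr, hvx⟩
        · have := hu.sameRow_gap hS hv (by rw [hur, hvr]) huv
          obtain ⟨a, b⟩ := v; obtain ⟨x, y⟩ := u
          simp only [diag] at hur hvr this ⊢
          rw [le_abs] at this ⊢; omega
        · obtain ⟨a, b⟩ := v; obtain ⟨x, y⟩ := u; obtain ⟨p, q⟩ := t
          simp only [diag] at hur hvr hux hvx ⊢
          rw [le_abs]; omega
    · -- u on the second row: u.x ≥ t.x + 3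
      by_cases hvt : v = t
      · subst hvt
        have hpv : portX v v = UR (UL v) := by simp [portX]
        rw [hpu, hpv, diag_ur, diag_ur]
        obtain ⟨a, b⟩ := v; obtain ⟨x, y⟩ := u
        simp only [diag, UL_fst, UL_snd] at hur hux ⊢
        rw [le_abs]; omega
      · have hpv : portX t v = UR v := by simp [portX, hvt]
        rw [hpu, hpv, diag_ur, diag_ur]
        rcases hv.row_cases hS ht with ⟨hvr, -, -⟩ | ⟨hvr, hvx⟩
        · have hvx := hv.topRow_le_of_L_mem hS ht hL hvr hvt
          obtain ⟨a, b⟩ := v; obtain ⟨x, y⟩ := u; obtain ⟨p, q⟩ := t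
          simp only [diag] at hur hvr hux hvx ⊢
          rw [le_abs]; omega
        · have := hu.sameRow_gap hS hv (by rw [hur, hvr]) huv
          obtain ⟨a, b⟩ := v; obtain ⟨x, y⟩ := u
          simp only [diag] at hur hvr this ⊢
          rw [le_abs] at this ⊢; omega
  by_cases hdt : d = t
  · subst hdt
    have := key hd' hd hne.symm (fun e => hne e.symm)
    rwa [abs_sub_comm] at this
  · exact key hd hd' hne hdt

/-- The ports of the roof of length `k` (`k ≥ 1`). [cite: MadrasSlade1993, §3.2 (proof of Theorem 3.2.3)] -/
def portR (t : Cell) (k : ℕ) (d : Cell) : Cell := if d = t then UR (roofCell t (k - 1)) else UR d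

/-- ★ **(P3) for the roof**: distinct hosts outside the run have ports on diagonals `≥ 4` apart (`L t ∉ S` is not needed; hosts inside the
run — only `e_{k−1}` can be one — are excluded, that polygon being the «roof-end» base).
[cite: MadrasSlade1993, §3.2 (proof of Theorem 3.2.3)] -/
theorem portR_diag_gap {S : Finset Cell} {t d d' : Cell} (hS : IsBrickSet S) (ht : IsLexmax S t) {k : ℕ} (hk : 1 ≤ k)
    (hrun : ∀ i < k, runCell t i ∈ S) (hend : runCell t k ∉ S)
    (hd : IsHost S d) (hd' : IsHost S d') (hne : d ≠ d') (hdr : ∀ i < k, d ≠ runCell t i) (hdr' : ∀ i < k, d' ≠ runCell t i) :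
    4 ≤ |diag (portR t k d) - diag (portR t k d')| := by
  have key : ∀ {u v : Cell}, IsHost S u → IsHost S v → u ≠ v → u ≠ t → (∀ i < k, u ≠ runCell t i) → (∀ i < k, v ≠ runCell t i) →
      4 ≤ |diag (portR t k u) - diag (portR t k v)| := by
    intro u v hu hv huv hut hur' hvr'
    have hpu : portR t k u = UR u := by simp [portR, hut]
    have hrt : diag (portR t k t) = t.1 + 2 * k - t.2 := by
      simp [portR, diag, roofCell]; omega
    rcases hu.row_cases hS ht with ⟨hur, -, hux⟩ | ⟨hur, -⟩
    · have hux : u.1 ≤ t.1 - 4 := by rcases hux with h | h; exact absurd h hut; exact h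
      by_cases hvt : v = t
      · subst hvt
        rw [hpu, hrt, diag_ur]
        obtain ⟨x, y⟩ := u; obtain ⟨a, b⟩ := v
        simp only [diag] at hur hux ⊢
        rw [le_abs]; omega
      · have hpv : portR t k v = UR v := by simp [portR, hvt]
        rw [hpu, hpv, diag_ur, diag_ur]
        rcases hv.row_cases hS ht with ⟨hvr, -, -⟩ | ⟨hvr, -⟩
        · have := hu.sameRow_gap hS hv (by rw [hur, hvr]) huv
          obtain ⟨a, b⟩ := v; obtain ⟨x, y⟩ := u
          simp only [diag] at hur hvr this ⊢
          rw [le_abs] at this ⊢; omega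
        · have hvx := hv.lowRow_ge_of_run hS ht hrun hend hvr hvr'
          obtain ⟨a, b⟩ := v; obtain ⟨x, y⟩ := u; obtain ⟨p, q⟩ := t
          simp only [diag] at hur hvr hux hvx ⊢
          rw [le_abs]; omega
    · have hux := hu.lowRow_ge_of_run hS ht hrun hend hur hur'
      by_cases hvt : v = t
      · subst hvt
        rw [hpu, hrt, diag_ur]
        obtain ⟨x, y⟩ := u; obtain ⟨a, b⟩ := v
        simp only [diag] at hur hux ⊢
        rw [le_abs]; omega
      · have hpv : portR t k v = UR v := by simp [portR, hvt]
        rw [hpu, hpv, diag_ur, diag_ur]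
        rcases hv.row_cases hS ht with ⟨hvr, -, hvx⟩ | ⟨hvr, -⟩
        · have hvx : v.1 ≤ t.1 - 4 := by rcases hvx with h | h; exact absurd h hvt; exact h
          obtain ⟨a, b⟩ := v; obtain ⟨x, y⟩ := u; obtain ⟨p, q⟩ := t
          simp only [diag] at hur hvr hux hvx ⊢
          rw [le_abs]; omega
        · have := hu.sameRow_gap hS hv (by rw [hur, hvr]) huv
          obtain ⟨a, b⟩ := v; obtain ⟨x, y⟩ := u
          simp only [diag] at hur hvr this ⊢
          rw [le_abs] at this ⊢; omega
  by_cases hdt : d = t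
  · subst hdt
    have := key hd' hd hne.symm (fun e => hne e.symm) hdr' hdr
    rwa [abs_sub_comm] at this
  · exact key hd hd' hne hdt hdr hdr'

end HexCell

end Literature.Probability.RandomPlanarGeometry.SAW
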